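import Mathlib
import Summits.Ventures.PercRepro2.Defs
import Summits.Ventures.PercRepro2.Graph
import Summits.Ventures.PercRepro2.Induced
import Summits.Ventures.PercRepro2.VdBKahn
import Summits.Ventures.PercRepro2.ReimerVdBK
import Summits.Ventures.PercRepro2.ReimerVdBKRegions
import Summits.Ventures.PercRepro2.ReimerVdBKZClosed
import Summits.Ventures.PercRepro2.ReimerVdBKZReduction
import Summits.Ventures.PercRepro2.ReimerVdBKZSplit
import Summits.Ventures.PercRepro2.ReimerVdBKZRecursion
import Summits.Ventures.PercRepro2.ReimerVdBKTypeWeight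
import Summits.Ventures.PercRepro2.ReimerVdBKPairType
import Summits.Ventures.PercRepro2.ReimerVdBKCoreDown
import Summits.Ventures.PercRepro2.ReimerVdBKCoreD
import Summits.Ventures.PercRepro2.ReimerVdBKDegTwoGraph
import Summits.Ventures.PercRepro2.ReimerVdBKDegTwoFlip
import Summits.Ventures.PercRepro2.ReimerVdBKDegTwoExpansion
import Summits.Ventures.PercRepro2.ReimerVdBKDegTwoCalc
import Summits.Ventures.PercRepro2.ReimerVdBKLeafGadget
import Summits.Ventures.PercRepro2.ReimerVdBKTwisted
import Summits.Ventures.PercRepro2.ReimerVdBKTied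
import Summits.Ventures.PercRepro2.ReimerVdBKDegThreeGraph
import Summits.Ventures.PercRepro2.ReimerVdBKDegThreeExpansion
import Summits.Ventures.PercRepro2.ReimerVdBKDegThreeCalc
import Summits.Ventures.PercRepro2.ReimerVdBKOneWorldDegTwo

/-!
# The one-world degree-2 rules, II: the doubly marked core-free vertices `A ∩ Y` and `B ∩ X`
(blind cell PercRepro2, mine-c g48; `conjectures/MINE-C.md` §57.5 addendum 1)

The companions of `coreDown_X_deg2` / `coreDown_Y_deg2` for a degree-2 vertex `v` that is CONNECTED by one world
and AVOIDED by the other: `v ∈ A ∩ Y` (world 1 reaches `v`, world 2 does not) or `v ∈ B ∩ X`.  In the pattern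
«`e₁` red, `e₂` blue» `v` is a leaf at `u₁` in world 1 and at `u₂` in world 2, so the marks of `v` move to `u₁`
(the world-1 mark) and to `u₂` (the world-2 mark) on `G° = G − v` (`mem_twoWorld_AY_TF`, `mem_twoWorld_BX_TF`;
the world-1 connection mark must leave `v`, which is isolated in `G°`, so the instance is written with
`A = insert v A'`).  The right-hand instance of a `B ∩ X` vertex is an `A ∩ Y` vertex, whose expansion matches
the two `G°`-terms crosswise.  THEOREMS `coreDown_AY_deg2`, `coreDown_BX_deg2`: (CORE↓) at `N` on the tied
sub-cube of the star and (CORE↓) at `N` on `G°` for the two instances with the marks moved to `(u₁, u₂)` resp.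
`(u₂, u₁)` give (CORE↓) at `N` on `G` — again without a pin.
-/

namespace Summit.Ventures.PercRepro2
namespace ReimerVdBK
open Classical

variable {V : Type*} {E : Type*} [Fintype E] [DecidableEq E] [Fintype V] [DecidableEq V]
variable (ends : E → Sym2 V) (s : V)

section Transfer
variable {v u₁ u₂ : V} {e₁ e₂ : E} (A' X B B' Y : Finset V)

omit [Fintype E] [Fintype V] in
/-- **`e₁` open, `e₂` closed, `v ∈ A ∩ Y`** (`A = insert v A'`, `v ∉ A'`, `v ∉ X ∪ B`): the two-world event on `G`
is the two-world event on `G°` with the world-1 mark of `v` moved to `u₁` and the world-2 avoidance to `u₂`. -/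
lemma mem_twoWorld_AY_TF (hd : Deg2 ends v u₁ u₂ e₁ e₂) (hsv : s ≠ v) (hvA : v ∉ A') (hvY : v ∈ Y)
    (hv : v ∉ X ∪ B) {ω : Config E} (h1 : ω e₁ = true) (h2 : ω e₂ = false) :
    ω ∈ twoWorld ends s (insert v A') X B Y ↔
      ω ∈ twoWorld (endsLoop ends v e₁ e₂) s (insert u₁ A') X B (insert u₂ Y) := by
  have hA : ∀ a ∈ A', a ≠ v := fun a ha hav => hvA (hav ▸ ha)
  have hX : ∀ x ∈ X, x ≠ v := fun x hx hxv => hv (hxv ▸ Finset.mem_union_left _ hx)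
  have hB : ∀ b ∈ B, b ≠ v := fun b hb hbv => hv (hbv ▸ Finset.mem_union_right _ hb)
  obtain ⟨hc1, hv1⟩ := conn_iff_endsLoop ends s hd hsv h1 h2
  have h1' : compl ω e₂ = true := by simp [compl_apply, h2]
  have h2' : compl ω e₁ = false := by simp [compl_apply, h1]
  obtain ⟨hc2, hv2⟩ := conn_iff_endsLoop ends s hd.swap hsv h1' h2'
  rw [endsLoop_swap ends hd.ne] at hc2 hv2
  have hiso := not_conn_endsLoop ends s hd hsv (compl ω)
  rw [mem_twoWorld_iff, mem_twoWorld_iff]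
  simp only [mem_K₁, mem_K₂]
  constructor
  · rintro ⟨hA', hX', hB', hY'⟩
    refine ⟨?_, fun x hx hc => hX' x hx ((hc1 x (hX x hx)).2 hc),
      fun b hb => (hc2 b (hB b hb)).1 (hB' b hb), ?_⟩
    · intro a ha
      rcases Finset.mem_insert.1 ha with rfl | ha
      · exact hv1.1 (hA' v (Finset.mem_insert_self _ _))
      · exact (hc1 a (hA a ha)).1 (hA' a (Finset.mem_insert_of_mem ha))
    · intro y hy hc
      rcases Finset.mem_insert.1 hy with rfl | hy
      · exact hY' v hvY (hv2.2 hc)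
      · by_cases hyv : y = v
        · subst hyv; exact hiso hc
        · exact hY' y hy ((hc2 y hyv).2 hc)
  · rintro ⟨hA', hX', hB', hY'⟩
    refine ⟨?_, fun x hx hc => hX' x hx ((hc1 x (hX x hx)).1 hc),
      fun b hb => (hc2 b (hB b hb)).2 (hB' b hb), ?_⟩
    · intro a ha
      rcases Finset.mem_insert.1 ha with rfl | ha
      · exact hv1.2 (hA' u₁ (Finset.mem_insert_self _ _))
      · exact (hc1 a (hA a ha)).2 (hA' a (Finset.mem_insert_of_mem ha))
    · intro y hy hc
      by_cases hyv : y = v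
      · subst hyv; exact hY' u₂ (Finset.mem_insert_self _ _) (hv2.1 hc)
      · exact hY' y (Finset.mem_insert_of_mem hy) ((hc2 y hyv).1 hc)

omit [Fintype E] [Fintype V] in
/-- **`e₁` open, `e₂` closed, `v ∈ B ∩ X`** (`B = insert v B'`, `v ∉ B'`, `v ∉ A ∪ Y`): the two-world event on `G`
is the two-world event on `G°` with the world-1 avoidance of `v` moved to `u₁` and the world-2 mark to `u₂`. -/
lemma mem_twoWorld_BX_TF (A : Finset V) (hd : Deg2 ends v u₁ u₂ e₁ e₂) (hsv : s ≠ v) (hvB : v ∉ B') (hvX : v ∈ X)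
    (hv : v ∉ A ∪ Y) {ω : Config E} (h1 : ω e₁ = true) (h2 : ω e₂ = false) :
    ω ∈ twoWorld ends s A X (insert v B') Y ↔
      ω ∈ twoWorld (endsLoop ends v e₁ e₂) s A (insert u₁ X) (insert u₂ B') Y := by
  have hA : ∀ a ∈ A, a ≠ v := fun a ha hav => hv (hav ▸ Finset.mem_union_left _ ha)
  have hB : ∀ b ∈ B', b ≠ v := fun b hb hbv => hvB (hbv ▸ hb)
  have hY : ∀ y ∈ Y, y ≠ v := fun y hy hyv => hv (hyv ▸ Finset.mem_union_right _ hy)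
  obtain ⟨hc1, hv1⟩ := conn_iff_endsLoop ends s hd hsv h1 h2
  have h1' : compl ω e₂ = true := by simp [compl_apply, h2]
  have h2' : compl ω e₁ = false := by simp [compl_apply, h1]
  obtain ⟨hc2, hv2⟩ := conn_iff_endsLoop ends s hd.swap hsv h1' h2'
  rw [endsLoop_swap ends hd.ne] at hc2 hv2
  have hiso := not_conn_endsLoop ends s hd hsv ω
  rw [mem_twoWorld_iff, mem_twoWorld_iff]
  simp only [mem_K₁, mem_K₂]
  constructor
  · rintro ⟨hA', hX', hB', hY'⟩
    refine ⟨fun a ha => (hc1 a (hA a ha)).1 (hA' a ha), ?_, ?_,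
      fun y hy hc => hY' y hy ((hc2 y (hY y hy)).2 hc)⟩
    · intro x hx hc
      rcases Finset.mem_insert.1 hx with rfl | hx
      · exact hX' v hvX (hv1.2 hc)
      · by_cases hxv : x = v
        · subst hxv; exact hiso hc
        · exact hX' x hx ((hc1 x hxv).2 hc)
    · intro b hb
      rcases Finset.mem_insert.1 hb with rfl | hb
      · exact hv2.1 (hB' v (Finset.mem_insert_self _ _))
      · exact (hc2 b (hB b hb)).1 (hB' b (Finset.mem_insert_of_mem hb))
  · rintro ⟨hA', hX', hB', hY'⟩
    refine ⟨fun a ha => (hc1 a (hA a ha)).2 (hA' a ha), ?_, ?_,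
      fun y hy hc => hY' y hy ((hc2 y (hY y hy)).1 hc)⟩
    · intro x hx hc
      by_cases hxv : x = v
      · subst hxv; exact hX' u₁ (Finset.mem_insert_self _ _) (hv1.1 hc)
      · exact hX' x (Finset.mem_insert_of_mem hx) ((hc1 x hxv).1 hc)
    · intro b hb
      rcases Finset.mem_insert.1 hb with rfl | hb
      · exact hv2.2 (hB' u₂ (Finset.mem_insert_self _ _))
      · exact (hc2 b (hB b hb)).2 (hB' b (Finset.mem_insert_of_mem hb))

end Transfer

section Expansion
variable {v u₁ u₂ : V} {e₁ e₂ : E} (A' X B B' Y N : Finset V)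

omit [Fintype E] [Fintype V] in
/-- The pointwise split for `v ∈ A ∩ Y`. -/
lemma caTerm_split_AY (hd : Deg2 ends v u₁ u₂ e₁ e₂) (hsv : s ≠ v) (hvA : v ∉ A') (hvY : v ∈ Y)
    (hv : v ∉ X ∪ B) (hvN : v ∉ N) (ω : Config E) :
    caTerm s N ends (insert v A') X B Y ω = sel (ω e₁) (ω e₂) (tiedFunN ends s (insert v A') X B Y N {e₁, e₂} ω)
      (caTerm s N (endsLoop ends v e₁ e₂) (insert u₁ A') X B (insert u₂ Y) ω)
      (caTerm s N (endsLoop ends v e₁ e₂) (insert u₂ A') X B (insert u₁ Y) ω) := by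
  cases h1 : ω e₁ <;> cases h2 : ω e₂
  · show caTerm s N ends (insert v A') X B Y ω = tiedFunN ends s (insert v A') X B Y N {e₁, e₂} ω
    exact caTerm_same ends s (insert v A') X B Y N hd.ne (h1.trans h2.symm)
  · show caTerm s N ends (insert v A') X B Y ω =
      caTerm s N (endsLoop ends v e₁ e₂) (insert u₂ A') X B (insert u₁ Y) ω
    have h1' : ω e₂ = true := h2
    have h2' : ω e₁ = false := h1
    have htw := mem_twoWorld_AY_TF ends s A' X B Y hd.swap hsv hvA hvY hv h1' h2'
    have hca := coreAvoid_iff_loop_TF ends s N hd.swap hsv hvN h1' h2'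
    rw [endsLoop_swap ends hd.ne] at htw hca
    unfold caTerm
    rw [htw, hca]
  · show caTerm s N ends (insert v A') X B Y ω =
      caTerm s N (endsLoop ends v e₁ e₂) (insert u₁ A') X B (insert u₂ Y) ω
    have htw := mem_twoWorld_AY_TF ends s A' X B Y hd hsv hvA hvY hv h1 h2
    have hca := coreAvoid_iff_loop_TF ends s N hd hsv hvN h1 h2
    unfold caTerm
    rw [htw, hca]
  · show caTerm s N ends (insert v A') X B Y ω = tiedFunN ends s (insert v A') X B Y N {e₁, e₂} ω
    exact caTerm_same ends s (insert v A') X B Y N hd.ne (h1.trans h2.symm)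

omit [Fintype E] [Fintype V] in
/-- The pointwise split for `v ∈ B ∩ X`. -/
lemma caTerm_split_BX (A : Finset V) (hd : Deg2 ends v u₁ u₂ e₁ e₂) (hsv : s ≠ v) (hvB : v ∉ B') (hvX : v ∈ X)
    (hv : v ∉ A ∪ Y) (hvN : v ∉ N) (ω : Config E) :
    caTerm s N ends A X (insert v B') Y ω = sel (ω e₁) (ω e₂) (tiedFunN ends s A X (insert v B') Y N {e₁, e₂} ω)
      (caTerm s N (endsLoop ends v e₁ e₂) A (insert u₁ X) (insert u₂ B') Y ω)
      (caTerm s N (endsLoop ends v e₁ e₂) A (insert u₂ X) (insert u₁ B') Y ω) := by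
  cases h1 : ω e₁ <;> cases h2 : ω e₂
  · show caTerm s N ends A X (insert v B') Y ω = tiedFunN ends s A X (insert v B') Y N {e₁, e₂} ω
    exact caTerm_same ends s A X (insert v B') Y N hd.ne (h1.trans h2.symm)
  · show caTerm s N ends A X (insert v B') Y ω =
      caTerm s N (endsLoop ends v e₁ e₂) A (insert u₂ X) (insert u₁ B') Y ω
    have h1' : ω e₂ = true := h2
    have h2' : ω e₁ = false := h1
    have htw := mem_twoWorld_BX_TF ends s X B' Y A hd.swap hsv hvB hvX hv h1' h2'
    have hca := coreAvoid_iff_loop_TF ends s N hd.swap hsv hvN h1' h2'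
    rw [endsLoop_swap ends hd.ne] at htw hca
    unfold caTerm
    rw [htw, hca]
  · show caTerm s N ends A X (insert v B') Y ω =
      caTerm s N (endsLoop ends v e₁ e₂) A (insert u₁ X) (insert u₂ B') Y ω
    have htw := mem_twoWorld_BX_TF ends s X B' Y A hd hsv hvB hvX hv h1 h2
    have hca := coreAvoid_iff_loop_TF ends s N hd hsv hvN h1 h2
    unfold caTerm
    rw [htw, hca]
  · show caTerm s N ends A X (insert v B') Y ω = tiedFunN ends s A X (insert v B') Y N {e₁, e₂} ω
    exact caTerm_same ends s A X (insert v B') Y N hd.ne (h1.trans h2.symm)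

/-- **The expansion at a degree-2 vertex `v ∈ A ∩ Y`**. -/
theorem four_mul_coreCount_AY (hd : Deg2 ends v u₁ u₂ e₁ e₂) (hsv : s ≠ v) (hvA : v ∉ A') (hvY : v ∈ Y)
    (hv : v ∉ X ∪ B) (hvN : v ∉ N) :
    4 * coreCount ends s (insert v A') X B Y N = 4 * coreTiedCount ends s (insert v A') X B Y N {e₁, e₂} +
      (coreCount (endsLoop ends v e₁ e₂) s (insert u₁ A') X B (insert u₂ Y) N +
        coreCount (endsLoop ends v e₁ e₂) s (insert u₂ A') X B (insert u₁ Y) N) := by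
  have hsplit : ∑ ω : Config E, caTerm s N ends (insert v A') X B Y ω =
      ∑ ω : Config E, (if ω e₁ = ω e₂ then tiedFunN ends s (insert v A') X B Y N {e₁, e₂} ω else 0) +
        (∑ ω : Config E, (if ω e₁ = true ∧ ω e₂ = false then
            caTerm s N (endsLoop ends v e₁ e₂) (insert u₁ A') X B (insert u₂ Y) ω else 0) +
          ∑ ω : Config E, (if ω e₁ = false ∧ ω e₂ = true then
            caTerm s N (endsLoop ends v e₁ e₂) (insert u₂ A') X B (insert u₁ Y) ω else 0)) := by
    rw [← sum_sel]
    exact Finset.sum_congr rfl fun ω _ => caTerm_split_AY ends s A' X B Y N hd hsv hvA hvY hv hvN ω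
  have h1 := four_mul_sum_pattern e₁ e₂ hd.ne
    (caTerm s N (endsLoop ends v e₁ e₂) (insert u₁ A') X B (insert u₂ Y))
    (fun ω => caTerm_loop_flip ends s N hd.ne (Or.inl rfl) (insert u₁ A') X B (insert u₂ Y) ω)
    (fun ω => caTerm_loop_flip ends s N hd.ne (Or.inr rfl) (insert u₁ A') X B (insert u₂ Y) ω) true false
  have h2 := four_mul_sum_pattern e₁ e₂ hd.ne
    (caTerm s N (endsLoop ends v e₁ e₂) (insert u₂ A') X B (insert u₁ Y))
    (fun ω => caTerm_loop_flip ends s N hd.ne (Or.inl rfl) (insert u₂ A') X B (insert u₁ Y) ω)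
    (fun ω => caTerm_loop_flip ends s N hd.ne (Or.inr rfl) (insert u₂ A') X B (insert u₁ Y) ω) false true
  rw [coreCount_eq_sum_caTerm, hsplit, sum_tied_same ends s (insert v A') X B Y N hd.ne,
    coreCount_eq_sum_caTerm, coreCount_eq_sum_caTerm]
  omega

/-- **The expansion at a degree-2 vertex `v ∈ B ∩ X`**. -/
theorem four_mul_coreCount_BX (A : Finset V) (hd : Deg2 ends v u₁ u₂ e₁ e₂) (hsv : s ≠ v) (hvB : v ∉ B')
    (hvX : v ∈ X) (hv : v ∉ A ∪ Y) (hvN : v ∉ N) :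
    4 * coreCount ends s A X (insert v B') Y N = 4 * coreTiedCount ends s A X (insert v B') Y N {e₁, e₂} +
      (coreCount (endsLoop ends v e₁ e₂) s A (insert u₁ X) (insert u₂ B') Y N +
        coreCount (endsLoop ends v e₁ e₂) s A (insert u₂ X) (insert u₁ B') Y N) := by
  have hsplit : ∑ ω : Config E, caTerm s N ends A X (insert v B') Y ω =
      ∑ ω : Config E, (if ω e₁ = ω e₂ then tiedFunN ends s A X (insert v B') Y N {e₁, e₂} ω else 0) +
        (∑ ω : Config E, (if ω e₁ = true ∧ ω e₂ = false then
            caTerm s N (endsLoop ends v e₁ e₂) A (insert u₁ X) (insert u₂ B') Y ω else 0) +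
          ∑ ω : Config E, (if ω e₁ = false ∧ ω e₂ = true then
            caTerm s N (endsLoop ends v e₁ e₂) A (insert u₂ X) (insert u₁ B') Y ω else 0)) := by
    rw [← sum_sel]
    exact Finset.sum_congr rfl fun ω _ => caTerm_split_BX ends s X B' Y N A hd hsv hvB hvX hv hvN ω
  have h1 := four_mul_sum_pattern e₁ e₂ hd.ne
    (caTerm s N (endsLoop ends v e₁ e₂) A (insert u₁ X) (insert u₂ B') Y)
    (fun ω => caTerm_loop_flip ends s N hd.ne (Or.inl rfl) A (insert u₁ X) (insert u₂ B') Y ω)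
    (fun ω => caTerm_loop_flip ends s N hd.ne (Or.inr rfl) A (insert u₁ X) (insert u₂ B') Y ω) true false
  have h2 := four_mul_sum_pattern e₁ e₂ hd.ne
    (caTerm s N (endsLoop ends v e₁ e₂) A (insert u₂ X) (insert u₁ B') Y)
    (fun ω => caTerm_loop_flip ends s N hd.ne (Or.inl rfl) A (insert u₂ X) (insert u₁ B') Y ω)
    (fun ω => caTerm_loop_flip ends s N hd.ne (Or.inr rfl) A (insert u₂ X) (insert u₁ B') Y ω) false true
  rw [coreCount_eq_sum_caTerm, hsplit, sum_tied_same ends s A X (insert v B') Y N hd.ne,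
    coreCount_eq_sum_caTerm, coreCount_eq_sum_caTerm]
  omega

/-- **The one-world degree-2 rule at `v ∈ A ∩ Y`** (`A = insert v A'`): (CORE↓) at `N` on the tied sub-cube of the
star and (CORE↓) at `N` on `G°` for the two instances with the marks of `v` moved to `(u₁, u₂)` resp. `(u₂, u₁)`
give (CORE↓) at `N` on `G`. -/
theorem coreDown_AY_deg2 (hd : Deg2 ends v u₁ u₂ e₁ e₂) (hsv : s ≠ v) (hvA : v ∉ A') (hvY : v ∈ Y)
    (hv : v ∉ X ∪ B) (hvN : v ∉ N) (hT : CoreDownTied ends s (insert v A') X B Y N {e₁, e₂})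
    (h1 : CoreDown (endsLoop ends v e₁ e₂) s (insert u₁ A') X B (insert u₂ Y) N)
    (h2 : CoreDown (endsLoop ends v e₁ e₂) s (insert u₂ A') X B (insert u₁ Y) N) :
    CoreDown ends s (insert v A') X B Y N := by
  have hvA'' : v ∉ A' ∪ B := fun h => (Finset.mem_union.1 h).elim hvA (fun hb => hv (Finset.mem_union_right _ hb))
  have hvY'' : v ∈ X ∪ Y := Finset.mem_union_right _ hvY
  have hv'' : v ∉ (∅ : Finset V) ∪ ∅ := by simp
  have hL := four_mul_coreCount_AY ends s A' X B Y N hd hsv hvA hvY hv hvN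
  have hR := four_mul_coreCount_AY ends s (A' ∪ B) ∅ ∅ (X ∪ Y) N hd hsv hvA'' hvY'' hv'' hvN
  unfold CoreDown at h1 h2 ⊢
  unfold CoreDownTied at hT
  rw [Finset.insert_union, Finset.union_insert] at h1 h2
  rw [Finset.insert_union] at hT ⊢
  have : 4 * coreCount ends s (insert v A') X B Y N ≤
      4 * coreCount ends s (insert v (A' ∪ B)) ∅ ∅ (X ∪ Y) N := by
    rw [hL, hR]
    have := Nat.add_le_add h1 h2
    omega
  exact Nat.le_of_mul_le_mul_left this (by norm_num)

/-- **The one-world degree-2 rule at `v ∈ B ∩ X`** (`B = insert v B'`): (CORE↓) at `N` on the tied sub-cube of the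
star and (CORE↓) at `N` on `G°` for the two instances with the marks of `v` moved to `(u₁, u₂)` resp. `(u₂, u₁)`
give (CORE↓) at `N` on `G` — the right-hand instance is an `A ∩ Y` vertex, whose two `G°`-terms match crosswise. -/
theorem coreDown_BX_deg2 (A : Finset V) (hd : Deg2 ends v u₁ u₂ e₁ e₂) (hsv : s ≠ v) (hvB : v ∉ B') (hvX : v ∈ X)
    (hv : v ∉ A ∪ Y) (hvN : v ∉ N) (hT : CoreDownTied ends s A X (insert v B') Y N {e₁, e₂})
    (h1 : CoreDown (endsLoop ends v e₁ e₂) s A (insert u₁ X) (insert u₂ B') Y N)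
    (h2 : CoreDown (endsLoop ends v e₁ e₂) s A (insert u₂ X) (insert u₁ B') Y N) :
    CoreDown ends s A X (insert v B') Y N := by
  have hvA'' : v ∉ A ∪ B' := fun h => (Finset.mem_union.1 h).elim (fun ha => hv (Finset.mem_union_left _ ha)) hvB
  have hvY'' : v ∈ X ∪ Y := Finset.mem_union_left _ hvX
  have hv'' : v ∉ (∅ : Finset V) ∪ ∅ := by simp
  have hL := four_mul_coreCount_BX ends s X B' Y N A hd hsv hvB hvX hv hvN
  have hR := four_mul_coreCount_AY ends s (A ∪ B') ∅ ∅ (X ∪ Y) N hd hsv hvA'' hvY'' hv'' hvN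
  unfold CoreDown at h1 h2 ⊢
  unfold CoreDownTied at hT
  rw [Finset.union_insert, Finset.insert_union] at h1 h2
  rw [Finset.union_insert] at hT ⊢
  have : 4 * coreCount ends s A X (insert v B') Y N ≤
      4 * coreCount ends s (insert v (A ∪ B')) ∅ ∅ (X ∪ Y) N := by
    rw [hL, hR]
    have := Nat.add_le_add h1 h2
    omega
  exact Nat.le_of_mul_le_mul_left this (by norm_num)

end Expansion

end ReimerVdBK
end Summit.Ventures.PercRepro2
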